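import Summits.AtomisticToContinuum.Crystallization.Theorems.FrustratedLawDichotomyMotifDoorE
import Summits.AtomisticToContinuum.Crystallization.Theorems.FrustratedLawDichotomyRuleToolkit

/-!
# FrustratedLawDichotomy · RULE TOOLKIT II: the capped crystallinity flag is a LOCAL feature; algebra of local features

`…RuleToolkit` (p827743) certifies `pairRule g f` for `ρ`-local site features `f` and proves `coordFeature r`, `truncEnergyFeature r` local.
With both directions of the motif transfer now in the tree (`…MotifLemmas.goodAt_of_motif` — extension; `…MotifDoorE.goodAtScale_restrict` —
restriction) the CAPPED CRYSTALLINITY FLAG itself is a certified local feature, so census rules may route transfers by «good / bad» (the physically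
natural direction: loosely-bad = topological sites are the deficit sites of T′):

* `goodAtScale_of_motif` — extension that keeps the cap (`GoodAtScale η D (y ∘ φ) c → GoodAtScale η D y (φ c)`, deep motif);
* ★ `goodFlag η D` (`= 𝟙[GoodAtScale η D y i]`) and `goodFlag_isLocal : η ≤ 3/10 → 13/10·D + 1 ≤ ρ → IsLocalFeature ρ (goodFlag η D)`;
* algebra: `IsLocalFeature.const / add / sub / mul / comp` (pointwise combinations and post-composition of local features are local), so e.g.
  `fun N y i => g₁ (truncEnergyFeature r N y i) * goodFlag η D N y i` is local by two lines;
* `pairRule_good_restricted` — the certified search-space member «clipped flow keyed on the two endpoint flags and the pair distance».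

[folklore] bookkeeping; 0 sorry.  Prover hand 2, gen 12 (decomp-a2c), `--supports stmt-AtomisticToContinuum-27623`.
-/

noncomputable section

namespace Summit.AtomisticToContinuum.Crystallization.Theorems.FrustratedLawDichotomyRuleToolkitGood

open scoped BigOperators Classical
open Summit.AtomisticToContinuum.Crystallization.Theorems.ChargedEnergyGapNegative (E3)
open Summit.AtomisticToContinuum.Crystallization.Theorems.FrustratedLawDichotomyLocalDischargingRule
open Summit.AtomisticToContinuum.Crystallization.Theorems.FrustratedLawDichotomyMotifLemmas
open Summit.AtomisticToContinuum.Crystallization.Theorems.FrustratedLawDichotomyMotifDoorE (goodAtScale_restrict)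
open Summit.AtomisticToContinuum.Crystallization.Theorems.FrustratedLawDichotomyRuleToolkit

/-! ## §1. Extension keeping the cap -/

/-- **Extension with the cap kept**: a capped-good centre of a deep motif is capped-good in the cluster (same scale `d ≤ D`). [folklore] -/
theorem goodAtScale_of_motif {η D ϱ : ℝ} {N M : ℕ} {y : Fin N → E3} {φ : Fin M → Fin N} {c : Fin M}
    (hS : ∀ k : Fin N, dist (y k) (y (φ c)) ≤ ϱ → k ∈ Set.range φ) (hdeep : 13 / 10 * D + 1 ≤ ϱ)
    (h : GoodAtScale η D (y ∘ φ) c) : GoodAtScale η D y (φ c) := by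
  obtain ⟨d, η', γ, A, hdD, hor⟩ := h
  have hsub : Set.range (y ∘ φ) ⊆ Set.range y := Set.range_comp_subset_range φ y
  have hball : ∀ s ∈ Set.range y, dist s (y (φ c)) ≤ ϱ → s ∈ Set.range (y ∘ φ) := by
    rintro s ⟨k, rfl⟩ hk
    obtain ⟨a, ha⟩ := hS k hk
    exact ⟨a, by simp [ha]⟩
  have hp : (y ∘ φ) c = y (φ c) := rfl
  rw [hp] at hor
  refine ⟨d, η', min γ 1, A, hdD, ?_⟩
  rcases hor with ⟨t, h⟩ | ⟨t, h⟩
  · have hdeep' : 13 / 10 * d + 1 ≤ ϱ := by have := h.1; nlinarith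
    exact Or.inl ⟨t, clauses_extend (fun u : ↥Literature.Geometry.DiscreteGeometry.fccKissingPattern => (u : E3)) hsub hball hdeep' h⟩
  · have hdeep' : 13 / 10 * d + 1 ≤ ϱ := by have := h.1; nlinarith
    exact Or.inr ⟨t, clauses_extend (fun u : ↥Literature.Geometry.DiscreteGeometry.hcpKissingPattern => (u : E3)) hsub hball hdeep' h⟩

/-! ## §2. The capped crystallinity flag as a local feature -/

/-- **`goodFlag η D`** — the indicator of `GoodAtScale η D` as a site feature. -/
def goodFlag (η D : ℝ) : SiteFeature := fun _ y i => if GoodAtScale η D y i then (1 : ℝ) else 0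

/-- ★ **The capped crystallinity flag is `ρ`-local** for `η ≤ 3/10` and `13/10·D + 1 ≤ ρ`. [folklore] -/
theorem goodFlag_isLocal {η D ρ : ℝ} (hη : η ≤ 3 / 10) (hD : 13 / 10 * D + 1 ≤ ρ) : IsLocalFeature ρ (goodFlag η D) := by
  intro N M y φ hφ a hsub
  unfold goodFlag
  have hiff : GoodAtScale η D (y ∘ φ) a ↔ GoodAtScale η D y (φ a) :=
    ⟨goodAtScale_of_motif hsub hD, goodAtScale_restrict hsub hD hη⟩
  by_cases h : GoodAtScale η D y (φ a)
  · rw [if_pos h, if_pos (hiff.2 h)]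
  · rw [if_neg h, if_neg (fun h' => h (hiff.1 h'))]

/-- `0 ≤ goodFlag ≤ 1`. [folklore] -/
theorem goodFlag_mem {η D : ℝ} {N : ℕ} (y : Fin N → E3) (i : Fin N) : 0 ≤ goodFlag η D N y i ∧ goodFlag η D N y i ≤ 1 := by
  unfold goodFlag
  split_ifs <;> norm_num

/-! ## §3. Algebra of local features -/

/-- Constants are local. [folklore] -/
theorem IsLocalFeature.const (ρ c : ℝ) : IsLocalFeature ρ (fun _ _ _ => c) := fun _ _ _ _ _ _ _ => rfl

/-- Sums of local features are local. [folklore] -/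
theorem IsLocalFeature.add {ρ : ℝ} {f g : SiteFeature} (hf : IsLocalFeature ρ f) (hg : IsLocalFeature ρ g) :
    IsLocalFeature ρ (fun N y i => f N y i + g N y i) :=
  fun N M y φ hφ a hsub => by simp only [hf N M y φ hφ a hsub, hg N M y φ hφ a hsub]

/-- Differences of local features are local. [folklore] -/
theorem IsLocalFeature.sub {ρ : ℝ} {f g : SiteFeature} (hf : IsLocalFeature ρ f) (hg : IsLocalFeature ρ g) :
    IsLocalFeature ρ (fun N y i => f N y i - g N y i) :=
  fun N M y φ hφ a hsub => by simp only [hf N M y φ hφ a hsub, hg N M y φ hφ a hsub]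

/-- Products of local features are local. [folklore] -/
theorem IsLocalFeature.mul {ρ : ℝ} {f g : SiteFeature} (hf : IsLocalFeature ρ f) (hg : IsLocalFeature ρ g) :
    IsLocalFeature ρ (fun N y i => f N y i * g N y i) :=
  fun N M y φ hφ a hsub => by simp only [hf N M y φ hφ a hsub, hg N M y φ hφ a hsub]

/-- Post-composition with any real function keeps locality. [folklore] -/
theorem IsLocalFeature.comp {ρ : ℝ} {f : SiteFeature} (hf : IsLocalFeature ρ f) (h : ℝ → ℝ) :
    IsLocalFeature ρ (fun N y i => h (f N y i)) :=
  fun N M y φ hφ a hsub => by simp only [hf N M y φ hφ a hsub]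

/-- Pairing two local features into one through a binary function keeps locality. [folklore] -/
theorem IsLocalFeature.comp₂ {ρ : ℝ} {f g : SiteFeature} (hf : IsLocalFeature ρ f) (hg : IsLocalFeature ρ g) (h : ℝ → ℝ → ℝ) :
    IsLocalFeature ρ (fun N y i => h (f N y i) (g N y i)) :=
  fun N M y φ hφ a hsub => by simp only [hf N M y φ hφ a hsub, hg N M y φ hφ a hsub]

/-! ## §4. A certified search-space member keyed on crystallinity -/

/-- **Energy-and-flag feature**: encode the pair `(truncEnergyFeature r, goodFlag η D)` into one local real feature via any `h : ℝ → ℝ → ℝ`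
(e.g. `h e b = e + 1000·b` to let `g` read both); local for `r ≤ ρ`, `η ≤ 3/10`, `13/10·D + 1 ≤ ρ`. [folklore] -/
theorem energyFlagFeature_isLocal {r η D ρ : ℝ} (h : ℝ → ℝ → ℝ) (hr : r ≤ ρ) (hη : η ≤ 3 / 10) (hD : 13 / 10 * D + 1 ≤ ρ) :
    IsLocalFeature ρ (fun N y i => h (truncEnergyFeature r N y i) (goodFlag η D N y i)) :=
  IsLocalFeature.comp₂ (truncEnergyFeature_isLocal hr) (goodFlag_isLocal hη hD) h

/-- ★ **Certified member**: a clipped finite-range pair rule whose transfer reads the pair distance, both endpoint energies AND both endpoint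
crystallinity flags — `HasRange R′ ∧ IsLocal ρ ∧ IsBounded B` are theorems. [folklore] -/
theorem pairRule_good_restricted {R' ρ r η D B : ℝ} (hB : 0 ≤ B) (hr : r ≤ ρ) (hη : η ≤ 3 / 10) (hD : 13 / 10 * D + 1 ≤ ρ)
    (h : ℝ → ℝ → ℝ) (P : ℝ → ℝ → ℝ → ℝ) :
    let f : SiteFeature := fun N y i => h (truncEnergyFeature r N y i) (goodFlag η D N y i)
    let g : ℝ → ℝ → ℝ → ℝ := fun d a b => if d ≤ R' then max (-B) (min B (P d a b)) else 0
    HasRange R' (pairRule g f) ∧ IsLocal ρ (pairRule g f) ∧ IsBounded B (pairRule g f) := by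
  refine pairRule_restricted hB (fun d a b hd => ?_) (fun d a b => ?_) (energyFlagFeature_isLocal h hr hη hD)
  · simp only [if_neg (not_le.mpr hd)]
  · split_ifs
    · exact abs_le.mpr ⟨le_max_left _ _, max_le (by linarith) (min_le_left _ _)⟩
    · simpa using hB

end Summit.AtomisticToContinuum.Crystallization.Theorems.FrustratedLawDichotomyRuleToolkitGood

end
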